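/-
Copyright (c) 2026. All rights reserved.
Released under Apache 2.0 license as described in the file LICENSE.
Authors: abc-iut cell, wave-2 seat abc-iut-L3-t11 (gen 2; row (β)-3: the finite-level branch dictionary of a
Galois tower — transitions between levels).
-/
import Literature.AnabelianGeometry.SemiGraphs.GaloisCoveringTorsor
import Literature.AnabelianGeometry.SemiGraphs.CoveringHomImage
import Literature.AnabelianGeometry.SemiGraphs.TemperedPiTreesTrans
import HarnessLib

/-!
# [SemiAnbd] Prop 3.6 / Thm 3.7 (iii): descent of Galois automorphisms along the finite levels of a tower

Mochizuki, *Semi-graphs of anabelioids*, Publ. RIMS **42** (2006) [MochizukiSemiAnbd2006], §3 p. 38 ("we may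
choose compatible maps … hence `Gal(𝒢_{∞,j}/𝒢) → Gal(𝒢_{∞,i}/𝒢)`") and p. 41 (proof of Thm. 3.7 (iii): the finite
Galois levels `𝒢_j` with their underlying semi-graphs `𝔾_j` and "natural maps `V_i → V_j`, `E_i → E_j`"),
Definition 2.2 (i) p. 23 / Remark 2.2.1 p. 24 (the branch dictionary is natural in the covering).

For a morphism `f : T ⟶ S` of connected coverings with point-transitive endomorphisms (e.g. two consecutive
levels `D.g n : D.S (n+1) ⟶ D.S n` of abc-iut-L3-t9's `GaloisLevelData`), every automorphism of `T` DESCENDS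
uniquely along `f` (`CovObj.autDesc`, `CovObj.autDescHom : Aut T →* Aut S`, surjective), compatibly with the
base-point embeddings of `GaloisCoveringTorsor.lean` (`autDescHom_ptHom`) and with the branches
(`branchMap_orbitGraphMap_brOf`).  For a tower `D`: the finite-level descent `D.levelDesc n`, its square with
abc-iut-L3-t9's `descendBaseAut ∘ proj` (`descendBaseAut_proj_succ` — the action of `π₁^temp` on the finite
coverings is compatible with the transitions), and the level completion `D.levelGal = ∏ₙ Aut (D.S n)` (a bare
group; print works inside `π̂₁(𝒢)`) with `D.toLevelGal : c.G →* D.levelGal`, `g ↦ (descendBaseAut_n (ρ_n g))_n`.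
Nothing here takes a side on [IUTchIII] Cor. 3.12.
-/

namespace Literature.AnabelianGeometry.SemiGraphs

namespace ProfiniteSemiGraph

open CategoryTheory Topology
open Literature.AlgebraicGeometry.Frobenioids.QuasiTemperoid.BTempConnected (ρ_one_apply
  ρ_mul_apply ρ_inv_apply ρ_apply_inv)

universe u

variable {𝒢 : ProfiniteSemiGraph.{u}}

/-! ### Descent of automorphisms along a morphism of Galois coverings -/

section Desc

variable {T S : CovObj 𝒢} (f : T ⟶ S)
  (hconnT : ∀ p q : T.Point, T.SameComponent p q)
  (hconnS : ∀ p q : S.Point, S.SameComponent p q)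
  (htransS : ∀ (v : 𝒢.graph.Vertex) (x x' : (S.SV v).obj.V), ∃ σ : S ⟶ S, (σ.fV v).hom.hom x = x')
  {v₀ : 𝒢.graph.Vertex} (t₀ : (T.SV v₀).obj.V)

include hconnT hconnS htransS t₀

/-- Existence of the descended automorphism (the automorphism of `S` moving `f t₀` to `f (σ t₀)`; the square
commutes at `t₀`, hence everywhere by rigidity). [cite: MochizukiSemiAnbd2006, Prop 3.6 p.38] -/
theorem CovObj.exists_autDesc (σ : Aut T) : ∃ τ : Aut S, σ.hom ≫ f = f ≫ τ.hom := by
  obtain ⟨τ, hτ⟩ := S.exists_aut_fV_eq hconnS htransS ((f.fV v₀).hom.hom t₀)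
    ((f.fV v₀).hom.hom ((σ.hom.fV v₀).hom.hom t₀))
  exact ⟨τ, T.hom_eq_of_fV_apply_eq hconnT _ _ t₀ (by
    change (f.fV v₀).hom.hom ((σ.hom.fV v₀).hom.hom t₀) = (τ.hom.fV v₀).hom.hom ((f.fV v₀).hom.hom t₀)
    rw [hτ])⟩

omit hconnT htransS in
/-- Uniqueness of the descended automorphism. [cite: MochizukiSemiAnbd2006, Prop 3.6 p.38] -/
theorem CovObj.autDesc_unique' (σ : Aut T) (τ τ' : Aut S) (h : σ.hom ≫ f = f ≫ τ.hom)
    (h' : σ.hom ≫ f = f ≫ τ'.hom) : τ = τ' := by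
  refine S.aut_eq_of_fV_eq hconnS ((f.fV v₀).hom.hom t₀) ?_
  have e := congrArg (fun ξ : T ⟶ S => (ξ.fV v₀).hom.hom t₀) (h.symm.trans h')
  exact e

/-- **The descent `autDesc f σ` of an automorphism `σ` of `T` along `f : T ⟶ S`.**
[cite: MochizukiSemiAnbd2006, Prop 3.6 p.38] -/
noncomputable def CovObj.autDesc (σ : Aut T) : Aut S :=
  (CovObj.exists_autDesc f hconnT hconnS htransS t₀ σ).choose

/-- The defining square `σ ≫ f = f ≫ autDesc f σ`. [cite: MochizukiSemiAnbd2006, Prop 3.6 p.38] -/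
theorem CovObj.hom_comp_eq_comp_autDesc (σ : Aut T) :
    σ.hom ≫ f = f ≫ (CovObj.autDesc f hconnT hconnS htransS t₀ σ).hom :=
  (CovObj.exists_autDesc f hconnT hconnS htransS t₀ σ).choose_spec

/-- Uniqueness: any `τ` completing the square is `autDesc f σ`. [cite: MochizukiSemiAnbd2006, Prop 3.6 p.38] -/
theorem CovObj.autDesc_unique (σ : Aut T) (τ : Aut S) (h : σ.hom ≫ f = f ≫ τ.hom) :
    τ = CovObj.autDesc f hconnT hconnS htransS t₀ σ :=
  CovObj.autDesc_unique' f hconnS t₀ σ τ _ h (CovObj.hom_comp_eq_comp_autDesc f hconnT hconnS htransS t₀ σ)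

/-- Pointwise form of the square on vertex fibres: `f (σ y) = (autDesc f σ) (f y)`.
[cite: MochizukiSemiAnbd2006, Prop 3.6 p.38] -/
theorem CovObj.fV_autDesc_apply (σ : Aut T) {v : 𝒢.graph.Vertex} (y : (T.SV v).obj.V) :
    (f.fV v).hom.hom ((σ.hom.fV v).hom.hom y) =
      ((CovObj.autDesc f hconnT hconnS htransS t₀ σ).hom.fV v).hom.hom ((f.fV v).hom.hom y) :=
  congrArg (fun ξ : T ⟶ S => (ξ.fV v).hom.hom y)
    (CovObj.hom_comp_eq_comp_autDesc f hconnT hconnS htransS t₀ σ)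

/-- **The descent homomorphism `Aut T →* Aut S`** ("`Gal(𝒢_j/𝒢) → Gal(𝒢_i/𝒢)`").
[cite: MochizukiSemiAnbd2006, Prop 3.6 p.38] -/
noncomputable def CovObj.autDescHom : Aut T →* Aut S where
  toFun := CovObj.autDesc f hconnT hconnS htransS t₀
  map_one' := (CovObj.autDesc_unique f hconnT hconnS htransS t₀ 1 1 (by
    change 𝟙 T ≫ f = f ≫ 𝟙 S
    rw [Category.id_comp, Category.comp_id])).symm
  map_mul' σ σ' := (CovObj.autDesc_unique f hconnT hconnS htransS t₀ (σ * σ') _ (by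
    change (σ'.hom ≫ σ.hom) ≫ f = f ≫ ((CovObj.autDesc f hconnT hconnS htransS t₀ σ').hom ≫
      (CovObj.autDesc f hconnT hconnS htransS t₀ σ).hom)
    rw [Category.assoc, CovObj.hom_comp_eq_comp_autDesc f hconnT hconnS htransS t₀ σ, ← Category.assoc,
      CovObj.hom_comp_eq_comp_autDesc f hconnT hconnS htransS t₀ σ', Category.assoc])).symm

/-- `autDescHom` unfolded. [cite: MochizukiSemiAnbd2006, Prop 3.6 p.38] -/
theorem CovObj.autDescHom_apply (σ : Aut T) :
    CovObj.autDescHom f hconnT hconnS htransS t₀ σ = CovObj.autDesc f hconnT hconnS htransS t₀ σ := rfl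

/-- **Descent is surjective** (every automorphism of `S` lifts to `T`), for `T` with point-transitive
endomorphisms too: lift `τ (f t₀)` to `T` and move `t₀` there. [cite: MochizukiSemiAnbd2006, Prop 3.6 p.38] -/
theorem CovObj.autDescHom_surjective
    (htransT : ∀ (v : 𝒢.graph.Vertex) (x x' : (T.SV v).obj.V), ∃ σ : T ⟶ T, (σ.fV v).hom.hom x = x') :
    Function.Surjective (CovObj.autDescHom f hconnT hconnS htransS t₀) := by
  intro τ
  obtain ⟨t₁, ht₁⟩ := CovHom.exists_preimage_of_sameComponent f t₀
    ((τ.hom.fV v₀).hom.hom ((f.fV v₀).hom.hom t₀)) (hconnS _ _)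
  obtain ⟨σ, hσ⟩ := T.exists_aut_fV_eq hconnT htransT t₀ t₁
  refine ⟨σ, (CovObj.autDesc_unique f hconnT hconnS htransS t₀ σ τ ?_).symm⟩
  refine T.hom_eq_of_fV_apply_eq hconnT _ _ t₀ ?_
  change (f.fV v₀).hom.hom ((σ.hom.fV v₀).hom.hom t₀) = (τ.hom.fV v₀).hom.hom ((f.fV v₀).hom.hom t₀)
  rw [hσ, ht₁]

/-- **Compatibility with the base-point embeddings**: if `f t = s` then `autDescHom f ∘ ψ_t = ψ_s`
(the branch dictionary is natural in the level). [cite: MochizukiSemiAnbd2006, Rmk. 2.2.1 p.24] -/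
theorem CovObj.autDescHom_ptHom
    (htransT : ∀ (v : 𝒢.graph.Vertex) (x x' : (T.SV v).obj.V), ∃ σ : T ⟶ T, (σ.fV v).hom.hom x = x')
    {v : 𝒢.graph.Vertex} (t : (T.SV v).obj.V) (s : (S.SV v).obj.V) (hts : (f.fV v).hom.hom t = s)
    (h : 𝒢.Gv v) :
    CovObj.autDescHom f hconnT hconnS htransS t₀ (T.ptHom hconnT htransT t h) = S.ptHom hconnS htransS s h := by
  refine (CovObj.autDesc_unique f hconnT hconnS htransS t₀ _ _ ?_).symm
  refine T.hom_eq_of_fV_apply_eq hconnT _ _ t ?_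
  change (f.fV v).hom.hom (((T.ptHom hconnT htransT t h).hom.fV v).hom.hom t) =
    ((S.ptHom hconnS htransS s h).hom.fV v).hom.hom ((f.fV v).hom.hom t)
  rw [T.ptHom_apply, CovHom.fV_ρ, hts, S.ptHom_apply]

omit hconnT hconnS htransS t₀ in
/-- **Compatibility with the branches**: `𝔾(f)` maps the branch through `y` to the branch through `f y`.
[cite: MochizukiSemiAnbd2006, Def. 2.2(i) p.23] -/
theorem CovObj.branchMap_orbitGraphMap_brOf (b : 𝒢.graph.Branch) {v : 𝒢.graph.Vertex}
    (hb : 𝒢.graph.abuts b = some v) (y : (T.SV v).obj.V) :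
    (CovObj.orbitGraphMap f).branchMap (T.brOf b hb y) = S.brOf b hb ((f.fV v).hom.hom y) := by
  refine Subtype.ext (Prod.ext rfl ?_)
  change (Quot.mk S.ERel ⟨𝒢.graph.edgeOf b, (f.fE _).hom.hom ((T.glue b v hb).inv.hom.hom y)⟩ : S.OEdge) =
    Quot.mk S.ERel ⟨𝒢.graph.edgeOf b, (S.glue b v hb).inv.hom.hom ((f.fV v).hom.hom y)⟩
  congr 2
  apply Function.LeftInverse.injective (S.glue_inv_hom b v hb)
  rw [CovHom.glue_fE, T.glue_hom_inv, S.glue_hom_inv]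

omit hconnT hconnS htransS t₀ in
/-- `𝔾(f)` on vertex-orbits, on representatives. [cite: MochizukiSemiAnbd2006, Def. 2.2(i) p.23] -/
theorem CovObj.vertexMap_orbitGraphMap_mk {v : 𝒢.graph.Vertex} (y : (T.SV v).obj.V) :
    (CovObj.orbitGraphMap f).vertexMap (Quot.mk T.VRel ⟨v, y⟩) = Quot.mk S.VRel ⟨v, (f.fV v).hom.hom y⟩ :=
  rfl

end Desc

/-! ### The tower: finite-level descent and its square with `descendBaseAut ∘ proj` -/

namespace GaloisLevelData

variable (D : GaloisLevelData 𝒢) (h𝒢 : 𝒢.IsCountable)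
  (hconn : ∀ (n : ℕ) (p q : (D.S n).Point), (D.S n).SameComponent p q)

/-- **The descent `Gal(S (n+1)/𝒢) →* Gal(S n/𝒢)` along `D.g n`** at the finite Galois levels of the tower.
[cite: MochizukiSemiAnbd2006, Prop 3.6 p.38] -/
noncomputable def levelDesc (n : ℕ) : Aut (D.S (n + 1)) →* Aut (D.S n) :=
  CovObj.autDescHom (D.g n) (hconn (n + 1)) (hconn n) (D.htrans n) (D.x (n + 1))

/-- The square `σ ≫ g n = g n ≫ levelDesc n σ`. [cite: MochizukiSemiAnbd2006, Prop 3.6 p.38] -/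
theorem hom_comp_g_eq (n : ℕ) (σ : Aut (D.S (n + 1))) :
    σ.hom ≫ D.g n = D.g n ≫ (D.levelDesc hconn n σ).hom :=
  CovObj.hom_comp_eq_comp_autDesc (D.g n) (hconn (n + 1)) (hconn n) (D.htrans n) (D.x (n + 1)) σ

/-- Uniqueness of the finite-level descent. [cite: MochizukiSemiAnbd2006, Prop 3.6 p.38] -/
theorem levelDesc_unique (n : ℕ) (σ : Aut (D.S (n + 1))) (τ : Aut (D.S n))
    (h : σ.hom ≫ D.g n = D.g n ≫ τ.hom) : τ = D.levelDesc hconn n σ :=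
  CovObj.autDesc_unique (D.g n) (hconn (n + 1)) (hconn n) (D.htrans n) (D.x (n + 1)) σ τ h

/-- Pointwise square on vertex fibres. [cite: MochizukiSemiAnbd2006, Prop 3.6 p.38] -/
theorem fV_g_aut_apply (n : ℕ) (σ : Aut (D.S (n + 1))) {v : 𝒢.graph.Vertex}
    (y : ((D.S (n + 1)).SV v).obj.V) :
    ((D.g n).fV v).hom.hom ((σ.hom.fV v).hom.hom y) =
      ((D.levelDesc hconn n σ).hom.fV v).hom.hom (((D.g n).fV v).hom.hom y) :=
  CovObj.fV_autDesc_apply (D.g n) (hconn (n + 1)) (hconn n) (D.htrans n) (D.x (n + 1)) σ y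

/-- The finite-level descent is surjective. [cite: MochizukiSemiAnbd2006, Prop 3.6 p.38] -/
theorem levelDesc_surjective (n : ℕ) : Function.Surjective (D.levelDesc hconn n) :=
  CovObj.autDescHom_surjective (D.g n) (hconn (n + 1)) (hconn n) (D.htrans n) (D.x (n + 1))
    (D.htrans (n + 1))

/-- The finite-level descent intertwines the base-point embeddings of compatible base points.
[cite: MochizukiSemiAnbd2006, Rmk. 2.2.1 p.24] -/
theorem levelDesc_ptHom (n : ℕ) {v : 𝒢.graph.Vertex} (t : ((D.S (n + 1)).SV v).obj.V)
    (s : ((D.S n).SV v).obj.V) (hts : ((D.g n).fV v).hom.hom t = s) (h : 𝒢.Gv v) :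
    D.levelDesc hconn n ((D.S (n + 1)).ptHom (hconn (n + 1)) (D.htrans (n + 1)) t h) =
      (D.S n).ptHom (hconn n) (D.htrans n) s h :=
  CovObj.autDescHom_ptHom (D.g n) (hconn (n + 1)) (hconn n) (D.htrans n) (D.x (n + 1))
    (D.htrans (n + 1)) t s hts h

/-- **The action of `π₁^temp` on the finite Galois coverings is compatible with the transitions**:
`descendBaseAut_n (ρ_n γ) = levelDesc n (descendBaseAut_{n+1} (ρ_{n+1} γ))` (abc-iut-L3-t9's descent to the
finite level, `UniversalCoveringOverGalois.lean`, through abc-iut-L3-t6's naturality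
`descendBase_comp_eq_comp_descendBase`). [cite: MochizukiSemiAnbd2006, Thm 3.7(iii) p.41] -/
theorem descendBaseAut_proj_succ (n : ℕ) (γ : D.temperedPi h𝒢) :
    (D.S n).descendBaseAut h𝒢 (D.W n) (D.htrans n) (hconn n) (D.proj h𝒢 n γ) =
      D.levelDesc hconn n
        ((D.S (n + 1)).descendBaseAut h𝒢 (D.W (n + 1)) (D.htrans (n + 1)) (hconn (n + 1))
          (D.proj h𝒢 (n + 1) γ)) := by
  apply D.levelDesc_unique hconn n
  rw [← D.step_proj h𝒢 n γ]
  set σ := D.proj h𝒢 (n + 1) γ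
  have hd : (D.S n).descendBase h𝒢 (D.W n) (D.htrans n) (D.step h𝒢 n σ).hom =
      (D.S n).descendBase h𝒢 (CovObj.OVertex.map (D.g n) (D.W (n + 1))) (D.htrans n)
        (CovObj.descend (D.g n) (D.W (n + 1)) h𝒢 (D.htrans n) σ).hom :=
    (D.S n).descendBase_conjAut_eqToIso h𝒢 (D.hW n) (D.htrans n) _
  change (D.S (n + 1)).descendBase h𝒢 (D.W (n + 1)) (D.htrans (n + 1)) σ.hom ≫ D.g n =
    D.g n ≫ (D.S n).descendBase h𝒢 (D.W n) (D.htrans n) (D.step h𝒢 n σ).hom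
  rw [hd]
  exact (D.S n).descendBase_comp_eq_comp_descendBase h𝒢 (D.g n) (D.W (n + 1)) (D.htrans (n + 1))
    (hconn (n + 1)) (D.htrans n) σ.hom _ (CovObj.hom_comp_projOver (D.g n) (D.W (n + 1)) h𝒢 (D.htrans n) σ)

/-- The orbit-graph action of t6's `levelAct` is the orbit-graph map of the descended covering automorphism
(definitional bridge to `TemperedPiTrees.lean`). [cite: MochizukiSemiAnbd2006, Thm 3.7(iii) p.41] -/
theorem levelAct_hom_eq (n : ℕ) (γ : D.temperedPi h𝒢) :
    (D.levelAct h𝒢 hconn n γ).hom =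
      CovObj.orbitGraphMap ((D.S n).descendBaseAut h𝒢 (D.W n) (D.htrans n) (hconn n) (D.proj h𝒢 n γ)).hom :=
  rfl

/-! ### The completion along the finite Galois levels -/

/-- **The level completion `∏ₙ Gal(S n/𝒢)`** of the tower along its finite Galois levels, as a bare group (the
compatible families form the profinite completion; print works in `π̂₁(𝒢)`).
[cite: MochizukiSemiAnbd2006, Thm 3.7(iii) p.41] -/
abbrev levelGal : Type u := ∀ n : ℕ, Aut (D.S n)

/-- **`π₁^temp → ∏ₙ Gal(S n/𝒢)`**: the actions of `c.G` (through `ρ : c.G → π₁^temp = lim Aut(𝒢_{∞,n})`) on the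
finite Galois coverings `S n` (abc-iut-L3-t9's `descendBaseAut`). [cite: MochizukiSemiAnbd2006, Thm 3.7(iii) p.41] -/
noncomputable def toLevelGal (c : TemperedPiChart 𝒢) (ρ : c.G →* D.temperedPi h𝒢) : c.G →* D.levelGal :=
  MonoidHom.pi fun n => ((D.S n).descendBaseAut h𝒢 (D.W n) (D.htrans n) (hconn n)).comp ((D.proj h𝒢 n).comp ρ)

/-- Components of `toLevelGal`. [cite: MochizukiSemiAnbd2006, Thm 3.7(iii) p.41] -/
theorem toLevelGal_apply (c : TemperedPiChart 𝒢) (ρ : c.G →* D.temperedPi h𝒢) (g : c.G) (n : ℕ) :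
    D.toLevelGal h𝒢 hconn c ρ g n = (D.S n).descendBaseAut h𝒢 (D.W n) (D.htrans n) (hconn n) (D.proj h𝒢 n (ρ g)) :=
  rfl

/-- The components of `toLevelGal g` are compatible with the finite-level descent.
[cite: MochizukiSemiAnbd2006, Thm 3.7(iii) p.41] -/
theorem toLevelGal_succ (c : TemperedPiChart 𝒢) (ρ : c.G →* D.temperedPi h𝒢) (g : c.G) (n : ℕ) :
    D.toLevelGal h𝒢 hconn c ρ g n = D.levelDesc hconn n (D.toLevelGal h𝒢 hconn c ρ g (n + 1)) :=
  D.descendBaseAut_proj_succ h𝒢 hconn n (ρ g)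

/-- The orbit-graph action `levelAct` is the orbit-graph map of the `toLevelGal`-component.
[cite: MochizukiSemiAnbd2006, Thm 3.7(iii) p.41] -/
theorem levelAct_hom_eq_orbitGraphMap (c : TemperedPiChart 𝒢) (ρ : c.G →* D.temperedPi h𝒢) (g : c.G) (n : ℕ) :
    (D.levelAct h𝒢 hconn n (ρ g)).hom = CovObj.orbitGraphMap (D.toLevelGal h𝒢 hconn c ρ g n).hom :=
  rfl

/-- **Kernel of `toLevelGal`**: `g` acts trivially on EVERY finite Galois level `S n` iff all components
of `toLevelGal g` are `1` — the hypothesis shape of the compact-injectivity input (I0c)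
(`injOn_of_isCompact_of_ker_le`, `TemperedPiDeckCompact.lean`) and of (β)-ASM's
`injOn_toLevelGal_temperedPiChart`. [cite: MochizukiSemiAnbd2006, Thm 3.7(iii) p.41] -/
theorem mem_ker_toLevelGal_iff (c : TemperedPiChart 𝒢) (ρ : c.G →* D.temperedPi h𝒢) (g : c.G) :
    g ∈ (D.toLevelGal h𝒢 hconn c ρ).ker ↔
      ∀ n : ℕ, (D.S n).descendBaseAut h𝒢 (D.W n) (D.htrans n) (hconn n) (D.proj h𝒢 n (ρ g)) = 1 := by
  rw [MonoidHom.mem_ker]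
  constructor
  · intro h n
    rw [← D.toLevelGal_apply h𝒢 hconn c ρ g n, h]
    rfl
  · intro h
    funext n
    rw [D.toLevelGal_apply]
    exact h n

end GaloisLevelData

end ProfiniteSemiGraph

end Literature.AnabelianGeometry.SemiGraphs
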